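import Literature.MathematicalPhysics.QuantumFieldTheory.Balaban1983to89.B1Eq324BenfattoClassMarkov
import Literature.MathematicalPhysics.QuantumFieldTheory.Balaban1983to89.B1Eq324BenfattoMarkov
import HarnessLib

/-!
# `Balaban1983to89.B1Eq324BenfattoKernelOfPrecision` — [BenfattoEtAl1978] Appendix C 2) (C.6)–(C.8) p. 164 FOR THE CLASS OF
# [Balaban1985BackgroundPropagators] Sect. E p. 428: the zero-extended covariance kernel `K = A⁻¹` of a positive-definite precision `A` on a finite
# region `Λ ⊂ Q₀` — the DICTIONARY carrying seat n08-b's class theorems (finite index set, precision side) onto the chain's `Q₀ = ℤ^d` currency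
# (`condCov K Γ`, `condMean K Γ`), PROVED

statement-level skeleton of published theorems with citation tags; proofs where landed; nothing here is a claim about the
Yang–Mills mass gap

WHY THIS MODULE (cell `pub-ymgap`, seat `dag-n08-d` gen 11, OFFER-47 (J1) worded «BOTH — J1 first» by seat n08-b; node N08 [Balaban1985UV3]; the
[BenfattoEtAl1978] source chain behind the (α)-row `h324`).  T. Bałaban applies the Lemma of [BenfattoEtAl1978] p. 152 to his own fluctuation
covariances ([Balaban1982Higgs1] p. 616 «all the assumptions are satisfied»); the covariance in question is, in print ([Balaban1985BackgroundPropagators]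
Sect. E p. 428, right after (3.156)–(3.158)), *"defined by a positive definite operator C*Δ_kC with a lower bound γ₀ > 0 independent of k and U … This
property, together with a uniform exponential decay of C*Δ_kC implies bounds and uniform exponential decay … by the theorem of Sect. 5 in [2]"* — a
finite-volume Gaussian field whose PRECISION is uniformly elliptic with exponentially decaying entries.  Seat n08-b typed that class on an abstract finite
index set `ι` (`…B1Eq324BenfattoClassAppendixC`: Combes–Thomas decay of `A⁻¹`, the Schur complement = Dirichlet block inverse, (C.6)–(C.8) uniformly
in the conditioning set; `…B1Eq324BenfattoClassMarkov`: vanishing across a separating set); the ≈ 80 modules of the §5 road speak the covariance KERNEL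
`K : Q₀ → Q₀ → ℝ` and the chain's `B1Eq324BenfattoLemma.condCov K Γ` / `condMean K Γ`.  This file is the junction: for `Λ ⊂ Q₀` finite and
`A : Matrix Λ Λ ℝ` positive definite, the kernel `K(x, y) = [x, y ∈ Λ]·(A⁻¹)_{xy}` (a displayed hypothesis `hK`, no definition) is a positive-semidefinite
kernel on `Q₀`, its Gram matrices on `Γ ⊆ Λ` are those of `A⁻¹`, and `condCov K Γ` / `condMean K Γ` ARE seat n08-b's Schur-complement / regression
bodies read through `Λ ≃ ι` — so every class theorem becomes a statement in the census currency of `pub-ymgap-dag-n08-c/N08-BASICLEMMA-KERNEL-CENSUS.md`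
§5 (fields F1, F2, F4, F5, F7, F8, F9).

WHAT IS PROVED (standard axioms; no `sorry`; no definition).  `Λ ⊂ Q₀` finite, `A : Matrix Λ Λ ℝ`, `K` with
`hK : K x y = if x, y ∈ Λ then (A⁻¹)_{xy} else 0`, `Γ ⊆ Λ`, `Γ_Λ := Γ.subtype (· ∈ Λ)` (the same set as a `Finset Λ`).
* §1 the kernel: `kernel_apply_of_mem`, `kernel_eq_zero_of_not_mem_left/right`, `kernel_comm` (for `A` positive definite),
  ★ `isPosSemidefKernel_kernel` (F1: `K` is a PSD kernel on `Q₀`, so `gaussianFieldOfKernel K` — the class field as a measure on `Q₀ → ℝ` — exists and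
  the generic measure layer `…KernelRegression` / `…CondKernelGeneric` / `…KernelCondField` applies), `covGram_kernel_eq_submatrix`,
  `posDef_covGram_kernel` (Gram matrices on `Γ ⊆ Λ` positive definite), `isUnit_det_covGram_kernel`.
* §2 THE BRIDGE: ★ `condCov_kernel_eq_schur` — for `x, y ∈ Λ`, `condCov K Γ x y` IS n08-b's Schur body
  `(A⁻¹)_{xy} − Σ_{c,c′∈Γ_Λ} (A⁻¹)_{xc}((A⁻¹)_{Γ_ΛΓ_Λ})⁻¹_{cc′}(A⁻¹)_{c′y}`; ★ `condMean_kernel_eq_regression` — `condMean K Γ ξ x` IS the regression body;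
  `condCov_kernel_eq_zero_of_not_mem` (`x ∉ Λ` or `y ∉ Λ` ⇒ `0`), `condMean_kernel_eq_zero_of_not_mem`.
* §3 the class theorems in `Q₀` currency: ★ `condCov_kernel_eq_inv_submatrix` («Dirichlet boundary condition»: `condCov K Γ x y = ((A|_{Λ∖Γ})⁻¹)_{xy}`),
  ★ `covGram_condCov_kernel_eq_inv_submatrix` (the same as a Gram-matrix identity indexed by `↥(Λ ∖ Γ)`: `covGram (condCov K Γ) (Λ ∖ Γ) = (A|_{Λ∖Γ})⁻¹`),
  `posDef_submatrix_sdiff`,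
  `condCov_kernel_self_pos_le` (`0 < C^Γ_xx ≤ 1/γ`), ★ `abs_kernel_le_exp` (F2), ★ `abs_condCov_kernel_le_exp` (F4: `|C^Γ(x,y)| ≤ e^{−κ·dist x y}/(γ − J)` for
  ALL `x, y`, uniformly in `Γ ⊆ Λ`), ★ `abs_condMean_kernel_le_profile` (F5: `|u_Γ(ξ)(x)| ≤ (VM/(γ−J))·t·(1 + δ x)`), ★ `abs_kernel_sub_condCov_le_exp` (F7),
  ★ `condCov_kernel_eq_zero_of_separated` (F8, Markov for a separating conditioning set: `C^Γ(x,y) = 0` across the two sides, ALL `x, y`),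
  `condMean_kernel_congr_of_separated` (F9, locality of the centre); v1.1 (append-only): `sum_abs_kernel_le`, ★ `sum_abs_condCov_kernel_le` (F10,
  absolute row sums over any finite set of sites, uniformly in `Γ`), `kernel_self_le` / `kernel_self_pos_le` ((C.4): `0 ≤ K(x,x) ≤ 1/γ`, the
  diagonal input of the kernel-generic Appendix A and Lemma 2).
HONEST SCOPE.  A dictionary: every estimate is seat n08-b's, transported; the class is OUR reading of [Balaban1985BackgroundPropagators] p. 428 for the
purpose of [Balaban1982Higgs1] p. 616, not a printed definition; nothing of [Balaban1985UV3] / [Balaban1985UV2] is asserted; the generalised Basic Lemma is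
NOT stated; count-neutral for N08; nothing about d = 4, the continuum, OS axioms, a mass gap or the Clay problem.
-/

noncomputable section

open Finset Matrix
open scoped BigOperators Matrix

namespace Literature.MathematicalPhysics.QuantumFieldTheory.Balaban1983to89.B1Eq324BenfattoKernelOfPrecision

open Literature.MathematicalPhysics.QuantumFieldTheory
open Literature.MathematicalPhysics.QuantumFieldTheory.Balaban1983to89.B1Eq324BenfattoLemma
open Literature.MathematicalPhysics.QuantumFieldTheory.Balaban1983to89.B1Eq324BenfattoCondCentre
open Literature.MathematicalPhysics.QuantumFieldTheory.Balaban1983to89.B1Eq324BenfattoMarkov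
open Literature.MathematicalPhysics.QuantumFieldTheory.Balaban1983to89.B1Eq324BenfattoClassAppendixC
open Literature.MathematicalPhysics.QuantumFieldTheory.Balaban1983to89.B1Eq324BenfattoClassMarkov

variable {d : ℕ}

/-! ## §0  Two sums over `Λ` against indicator functions (kernel plumbing) -/

/-- kernel: a sum over `↥Λ` of an indicator at a lattice site is the value there (or `0`). [folklore] -/
private theorem sum_ite_coe_eq {Λ : Finset (B1Eq324BenfattoLemma.Site d)} (s : B1Eq324BenfattoLemma.Site d) (g : Λ → ℝ) :
    ∑ j : Λ, (if s = (j : B1Eq324BenfattoLemma.Site d) then g j else 0) = if hs : s ∈ Λ then g ⟨s, hs⟩ else 0 := by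
  classical
  by_cases hs : s ∈ Λ
  · rw [dif_pos hs, Finset.sum_eq_single ⟨s, hs⟩]
    · simp
    · intro j _ hj
      rw [if_neg]
      intro h
      exact hj (Subtype.ext h.symm)
    · intro h
      exact absurd (Finset.mem_univ _) h
  · rw [dif_neg hs]
    refine Finset.sum_eq_zero fun j _ => ?_
    rw [if_neg]
    intro h
    exact hs (h ▸ j.2)

section Kernel

variable {Λ : Finset (B1Eq324BenfattoLemma.Site d)} {A : Matrix Λ Λ ℝ}
  {K : B1Eq324BenfattoLemma.Site d → B1Eq324BenfattoLemma.Site d → ℝ}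
  (hK : ∀ x y, K x y = if h : x ∈ Λ ∧ y ∈ Λ then (A⁻¹ : Matrix Λ Λ ℝ) ⟨x, h.1⟩ ⟨y, h.2⟩ else 0)

/-- A positive-definite (real, symmetric) precision has a symmetric covariance `A⁻¹`. [cite: HornJohnson2013, §0.7.3 (inverse of a symmetric matrix)] -/
theorem inv_apply_comm (hA : A.PosDef) (i j : Λ) : (A⁻¹ : Matrix Λ Λ ℝ) i j = (A⁻¹ : Matrix Λ Λ ℝ) j i := by
  have hAt : Aᵀ = A := by
    have h := hA.isHermitian
    rwa [Matrix.IsHermitian, Matrix.conjTranspose_eq_transpose_of_trivial] at h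
  have h := Matrix.transpose_nonsing_inv A
  rw [hAt] at h
  have h2 := congrFun (congrFun h j) i
  rw [Matrix.transpose_apply] at h2
  exact h2

/-- kernel: a site of `Λ ∖ Γ` as an element of the complement of `Γ_Λ` in `Λ`. [folklore] -/
private theorem mem_compl_subtype {Γ : Finset (B1Eq324BenfattoLemma.Site d)} {x : B1Eq324BenfattoLemma.Site d} (hx : x ∈ Λ) (hxΓ : x ∉ Γ) :
    (⟨x, hx⟩ : Λ) ∈ (Γ.subtype (· ∈ Λ))ᶜ := by
  rw [Finset.mem_compl, Finset.mem_subtype]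
  exact hxΓ

include hK

/-! ## §1  The zero-extended kernel `K = [·,· ∈ Λ]·A⁻¹` on `Q₀` -/

/-- On `Λ` the kernel IS the covariance matrix `A⁻¹`. [cite: Balaban1985BackgroundPropagators, Sect. E p.428 (the class); BenfattoEtAl1978, Appendix C (C.2) p.164] -/
theorem kernel_apply_of_mem {x y : B1Eq324BenfattoLemma.Site d} (hx : x ∈ Λ) (hy : y ∈ Λ) :
    K x y = (A⁻¹ : Matrix Λ Λ ℝ) ⟨x, hx⟩ ⟨y, hy⟩ := by
  rw [hK, dif_pos ⟨hx, hy⟩]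

/-- Off `Λ` the kernel vanishes (first argument). [cite: Balaban1985BackgroundPropagators, Sect. E p.428 (the class)] -/
theorem kernel_eq_zero_of_not_mem_left {x : B1Eq324BenfattoLemma.Site d} (hx : x ∉ Λ) (y : B1Eq324BenfattoLemma.Site d) : K x y = 0 := by
  rw [hK, dif_neg fun h => hx h.1]

/-- Off `Λ` the kernel vanishes (second argument). [cite: Balaban1985BackgroundPropagators, Sect. E p.428 (the class)] -/
theorem kernel_eq_zero_of_not_mem_right (x : B1Eq324BenfattoLemma.Site d) {y : B1Eq324BenfattoLemma.Site d} (hy : y ∉ Λ) : K x y = 0 := by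
  rw [hK, dif_neg fun h => hy h.2]

/-- The kernel is symmetric (positive-definite precision). [cite: BenfattoEtAl1978, Appendix C (C.2) p.164 (class form)] -/
theorem kernel_comm (hA : A.PosDef) (x y : B1Eq324BenfattoLemma.Site d) : K x y = K y x := by
  by_cases hx : x ∈ Λ
  · by_cases hy : y ∈ Λ
    · rw [kernel_apply_of_mem hK hx hy, kernel_apply_of_mem hK hy hx, inv_apply_comm hA]
    · rw [kernel_eq_zero_of_not_mem_right hK x hy, kernel_eq_zero_of_not_mem_left hK hy]
  · rw [kernel_eq_zero_of_not_mem_left hK hx, kernel_eq_zero_of_not_mem_right hK y hx]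

/-- The kernel as a double indicator sum over `Λ`: `K(s,t) = Σ_{j,j′∈Λ} [s = j][t = j′](A⁻¹)_{jj′}`. [folklore] -/
private theorem kernel_eq_sum_ite (s t : B1Eq324BenfattoLemma.Site d) :
    K s t = ∑ j : Λ, ∑ j' : Λ, (if s = (j : B1Eq324BenfattoLemma.Site d) then (1 : ℝ) else 0) *
      ((if t = (j' : B1Eq324BenfattoLemma.Site d) then (1 : ℝ) else 0) * (A⁻¹ : Matrix Λ Λ ℝ) j j') := by
  classical
  have hinner : ∀ j : Λ, ∑ j' : Λ, (if t = (j' : B1Eq324BenfattoLemma.Site d) then (1 : ℝ) else 0) * (A⁻¹ : Matrix Λ Λ ℝ) j j' =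
      if ht : t ∈ Λ then (A⁻¹ : Matrix Λ Λ ℝ) j ⟨t, ht⟩ else 0 := by
    intro j
    rw [← sum_ite_coe_eq t (fun j' => (A⁻¹ : Matrix Λ Λ ℝ) j j')]
    refine Finset.sum_congr rfl fun j' _ => ?_
    by_cases h : t = (j' : B1Eq324BenfattoLemma.Site d)
    · rw [if_pos h, if_pos h, one_mul]
    · rw [if_neg h, if_neg h, zero_mul]
  calc K s t = if hs : s ∈ Λ then (if ht : t ∈ Λ then (A⁻¹ : Matrix Λ Λ ℝ) ⟨s, hs⟩ ⟨t, ht⟩ else 0) else 0 := by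
        by_cases hs : s ∈ Λ
        · by_cases ht : t ∈ Λ
          · rw [dif_pos hs, dif_pos ht, kernel_apply_of_mem hK hs ht]
          · rw [dif_pos hs, dif_neg ht, kernel_eq_zero_of_not_mem_right hK s ht]
        · rw [dif_neg hs, kernel_eq_zero_of_not_mem_left hK hs]
    _ = ∑ j : Λ, (if s = (j : B1Eq324BenfattoLemma.Site d) then (if ht : t ∈ Λ then (A⁻¹ : Matrix Λ Λ ℝ) j ⟨t, ht⟩ else 0) else 0) :=
        (sum_ite_coe_eq s (fun j => if ht : t ∈ Λ then (A⁻¹ : Matrix Λ Λ ℝ) j ⟨t, ht⟩ else 0)).symm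
    _ = ∑ j : Λ, ∑ j' : Λ, (if s = (j : B1Eq324BenfattoLemma.Site d) then (1 : ℝ) else 0) *
          ((if t = (j' : B1Eq324BenfattoLemma.Site d) then (1 : ℝ) else 0) * (A⁻¹ : Matrix Λ Λ ℝ) j j') := by
        refine Finset.sum_congr rfl fun j _ => ?_
        rw [← Finset.mul_sum, hinner j]
        by_cases h : s = (j : B1Eq324BenfattoLemma.Site d)
        · rw [if_pos h, if_pos h, one_mul]
        · rw [if_neg h, if_neg h, zero_mul]

/-- **F1 — THE CLASS KERNEL IS POSITIVE SEMIDEFINITE ON `Q₀`**: every finite Gram matrix of `K` is positive semidefinite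
(`vᵀ K_II v = wᵀ A⁻¹ w ≥ 0` with `w_j = Σ_{s∈I, s=j} v_s`), so the Gaussian field `gaussianFieldOfKernel K` of the class exists as a measure on
`Q₀ → ℝ` and the generic conditioning layer applies to it. [cite: Balaban1985BackgroundPropagators, Sect. E p.428 «defined by a positive definite operator»;
BenfattoEtAl1978, (1.1) p.144 (class form)] -/
theorem isPosSemidefKernel_kernel (hA : A.PosDef) : IsPosSemidefKernel K := by
  classical
  intro I
  -- the indicator matrix `P j s = [s = j]`, so that `K_II = Pᵀ A⁻¹ P`
  set P : Matrix Λ I ℝ := fun j s => if (s : B1Eq324BenfattoLemma.Site d) = (j : B1Eq324BenfattoLemma.Site d) then (1 : ℝ) else 0 with hP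
  have hGram : covGram K I = Pᵀ * (A⁻¹ : Matrix Λ Λ ℝ) * P := by
    ext s t
    rw [covGram_apply, kernel_eq_sum_ite hK]
    simp only [Matrix.mul_apply, Matrix.transpose_apply, hP]
    rw [Finset.sum_comm]
    refine Finset.sum_congr rfl fun j' _ => ?_
    rw [Finset.sum_mul]
    exact Finset.sum_congr rfl fun j _ => by ring
  rw [hGram]
  have h := Matrix.PosSemidef.conjTranspose_mul_mul_same hA.inv.posSemidef P
  rwa [Matrix.conjTranspose_eq_transpose_of_trivial] at h

/-- **The Gram matrix of `K` on `Γ ⊆ Λ` is the principal block of `A⁻¹`** (read through `Γ ≃ Γ_Λ`).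
[cite: BenfattoEtAl1978, Appendix C (C.6) p.164 (class form)] -/
theorem covGram_kernel_eq_submatrix {Γ : Finset (B1Eq324BenfattoLemma.Site d)} (hΓ : Γ ⊆ Λ) :
    covGram K Γ = (A⁻¹ : Matrix Λ Λ ℝ).submatrix (fun c : Γ => (⟨c, hΓ c.2⟩ : Λ)) (fun c : Γ => (⟨c, hΓ c.2⟩ : Λ)) := by
  ext c₁ c₂
  rw [covGram_apply, Matrix.submatrix_apply, kernel_apply_of_mem hK (hΓ c₁.2) (hΓ c₂.2)]

/-- **Gram matrices of the class kernel on `Γ ⊆ Λ` are positive definite** (principal blocks of `A⁻¹ ≻ 0`).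
[cite: BenfattoEtAl1978, Appendix C (C.6) p.164 (class form)] -/
theorem posDef_covGram_kernel (hA : A.PosDef) {Γ : Finset (B1Eq324BenfattoLemma.Site d)} (hΓ : Γ ⊆ Λ) : (covGram K Γ).PosDef := by
  rw [covGram_kernel_eq_submatrix hK hΓ]
  exact hA.inv.submatrix fun a b hab => Subtype.ext (by simpa using congrArg Subtype.val hab)

/-- The Gram determinant on `Γ ⊆ Λ` is a unit. [cite: BenfattoEtAl1978, Appendix C (C.6) p.164 (class form)] -/
theorem isUnit_det_covGram_kernel (hA : A.PosDef) {Γ : Finset (B1Eq324BenfattoLemma.Site d)} (hΓ : Γ ⊆ Λ) :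
    IsUnit (covGram K Γ).det :=
  (Matrix.isUnit_iff_isUnit_det _).mp (posDef_covGram_kernel hK hA hΓ).isUnit

/-! ## §2  The bridge: `condCov K Γ` and `condMean K Γ` ARE the Schur / regression bodies on `Λ` -/

/-- **THE BRIDGE FOR THE CONDITIONAL COVARIANCE**: for `Γ ⊆ Λ` and `x, y ∈ Λ`, the chain's `condCov K Γ x y` equals seat n08-b's Schur body
on the finite index set `Λ` at the conditioning set `Γ_Λ = Γ.subtype (· ∈ Λ)`:
`(A⁻¹)_{xy} − Σ_{c,c′∈Γ_Λ} (A⁻¹)_{xc}((A⁻¹)_{Γ_ΛΓ_Λ})⁻¹_{cc′}(A⁻¹)_{c′y}`. [cite: BenfattoEtAl1978, Appendix C (C.6)–(C.7) p.164 (class form)] -/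
theorem condCov_kernel_eq_schur {Γ : Finset (B1Eq324BenfattoLemma.Site d)} (hΓ : Γ ⊆ Λ) {x y : B1Eq324BenfattoLemma.Site d}
    (hx : x ∈ Λ) (hy : y ∈ Λ) :
    condCov K Γ x y = (A⁻¹ : Matrix Λ Λ ℝ) ⟨x, hx⟩ ⟨y, hy⟩ -
      ∑ c : Γ.subtype (· ∈ Λ), ∑ c' : Γ.subtype (· ∈ Λ),
        (A⁻¹ : Matrix Λ Λ ℝ) ⟨x, hx⟩ c * (covGram (A⁻¹ : Matrix Λ Λ ℝ) (Γ.subtype (· ∈ Λ)))⁻¹ c c' *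
          (A⁻¹ : Matrix Λ Λ ℝ) c' ⟨y, hy⟩ := by
  classical
  let e : ↥Γ ≃ ↥(Γ.subtype (· ∈ Λ)) :=
    { toFun := fun c => ⟨⟨c, hΓ c.2⟩, Finset.mem_subtype.mpr c.2⟩
      invFun := fun c' => ⟨((c' : Λ) : B1Eq324BenfattoLemma.Site d), Finset.mem_subtype.mp c'.2⟩
      left_inv := fun c => Subtype.ext rfl
      right_inv := fun c' => Subtype.ext (Subtype.ext rfl) }
  have hGram : covGram K Γ = (covGram (A⁻¹ : Matrix Λ Λ ℝ) (Γ.subtype (· ∈ Λ))).submatrix e e := by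
    ext c₁ c₂
    rw [covGram_apply, Matrix.submatrix_apply, covGram_apply, kernel_apply_of_mem hK (hΓ c₁.2) (hΓ c₂.2)]
    rfl
  have hinv : (covGram K Γ)⁻¹ = ((covGram (A⁻¹ : Matrix Λ Λ ℝ) (Γ.subtype (· ∈ Λ)))⁻¹).submatrix e e := by
    rw [hGram, Matrix.inv_submatrix_equiv]
  rw [condCov, kernel_apply_of_mem hK hx hy]
  congr 1
  set F : ↥(Γ.subtype (· ∈ Λ)) → ↥(Γ.subtype (· ∈ Λ)) → ℝ := fun a b =>
    (A⁻¹ : Matrix Λ Λ ℝ) ⟨x, hx⟩ a * (covGram (A⁻¹ : Matrix Λ Λ ℝ) (Γ.subtype (· ∈ Λ)))⁻¹ a b * (A⁻¹ : Matrix Λ Λ ℝ) b ⟨y, hy⟩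
    with hF
  have hterm : ∀ c c' : Γ, K x c * (covGram K Γ)⁻¹ c c' * K c' y = F (e c) (e c') := by
    intro c c'
    rw [hinv, Matrix.submatrix_apply, kernel_apply_of_mem hK hx (hΓ c.2), kernel_apply_of_mem hK (hΓ c'.2) hy]
    rfl
  calc ∑ c : Γ, ∑ c' : Γ, K x c * (covGram K Γ)⁻¹ c c' * K c' y
      = ∑ c : Γ, ∑ c' : Γ, F (e c) (e c') :=
        Finset.sum_congr rfl fun c _ => Finset.sum_congr rfl fun c' _ => hterm c c'
    _ = ∑ c : Γ, ∑ b : ↥(Γ.subtype (· ∈ Λ)), F (e c) b := Finset.sum_congr rfl fun c _ => e.sum_comp (fun b => F (e c) b)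
    _ = ∑ a : ↥(Γ.subtype (· ∈ Λ)), ∑ b : ↥(Γ.subtype (· ∈ Λ)), F a b :=
        e.sum_comp (fun a => ∑ b : ↥(Γ.subtype (· ∈ Λ)), F a b)

/-- **THE BRIDGE FOR THE CONDITIONAL CENTRE**: for `Γ ⊆ Λ` and `x ∈ Λ`, the chain's `condMean K Γ ξ x` equals seat n08-b's regression body
`Σ_{c,c′∈Γ_Λ} (A⁻¹)_{xc}((A⁻¹)_{Γ_ΛΓ_Λ})⁻¹_{cc′} ξ_{c′}`. [cite: BenfattoEtAl1978, Appendix C (C.7) p.164 (class form)] -/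
theorem condMean_kernel_eq_regression {Γ : Finset (B1Eq324BenfattoLemma.Site d)} (hΓ : Γ ⊆ Λ) (ξ : B1Eq324BenfattoLemma.Site d → ℝ)
    {x : B1Eq324BenfattoLemma.Site d} (hx : x ∈ Λ) :
    condMean K Γ ξ x =
      ∑ c : Γ.subtype (· ∈ Λ), ∑ c' : Γ.subtype (· ∈ Λ),
        (A⁻¹ : Matrix Λ Λ ℝ) ⟨x, hx⟩ c * (covGram (A⁻¹ : Matrix Λ Λ ℝ) (Γ.subtype (· ∈ Λ)))⁻¹ c c' *
          ξ ((c' : Λ) : B1Eq324BenfattoLemma.Site d) := by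
  classical
  let e : ↥Γ ≃ ↥(Γ.subtype (· ∈ Λ)) :=
    { toFun := fun c => ⟨⟨c, hΓ c.2⟩, Finset.mem_subtype.mpr c.2⟩
      invFun := fun c' => ⟨((c' : Λ) : B1Eq324BenfattoLemma.Site d), Finset.mem_subtype.mp c'.2⟩
      left_inv := fun c => Subtype.ext rfl
      right_inv := fun c' => Subtype.ext (Subtype.ext rfl) }
  have hGram : covGram K Γ = (covGram (A⁻¹ : Matrix Λ Λ ℝ) (Γ.subtype (· ∈ Λ))).submatrix e e := by
    ext c₁ c₂
    rw [covGram_apply, Matrix.submatrix_apply, covGram_apply, kernel_apply_of_mem hK (hΓ c₁.2) (hΓ c₂.2)]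
    rfl
  have hinv : (covGram K Γ)⁻¹ = ((covGram (A⁻¹ : Matrix Λ Λ ℝ) (Γ.subtype (· ∈ Λ)))⁻¹).submatrix e e := by
    rw [hGram, Matrix.inv_submatrix_equiv]
  rw [condMean]
  set F : ↥(Γ.subtype (· ∈ Λ)) → ↥(Γ.subtype (· ∈ Λ)) → ℝ := fun a b =>
    (A⁻¹ : Matrix Λ Λ ℝ) ⟨x, hx⟩ a * (covGram (A⁻¹ : Matrix Λ Λ ℝ) (Γ.subtype (· ∈ Λ)))⁻¹ a b * ξ ((b : Λ) : B1Eq324BenfattoLemma.Site d)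
    with hF
  have hterm : ∀ c c' : Γ, K x c * (covGram K Γ)⁻¹ c c' * ξ c' = F (e c) (e c') := by
    intro c c'
    rw [hinv, Matrix.submatrix_apply, kernel_apply_of_mem hK hx (hΓ c.2)]
    rfl
  calc ∑ c : Γ, ∑ c' : Γ, K x c * (covGram K Γ)⁻¹ c c' * ξ c'
      = ∑ c : Γ, ∑ c' : Γ, F (e c) (e c') :=
        Finset.sum_congr rfl fun c _ => Finset.sum_congr rfl fun c' _ => hterm c c'
    _ = ∑ c : Γ, ∑ b : ↥(Γ.subtype (· ∈ Λ)), F (e c) b := Finset.sum_congr rfl fun c _ => e.sum_comp (fun b => F (e c) b)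
    _ = ∑ a : ↥(Γ.subtype (· ∈ Λ)), ∑ b : ↥(Γ.subtype (· ∈ Λ)), F a b :=
        e.sum_comp (fun a => ∑ b : ↥(Γ.subtype (· ∈ Λ)), F a b)

/-- Off `Λ` the conditional covariance of the class kernel vanishes (either argument outside `Λ`).
[cite: BenfattoEtAl1978, Appendix C (C.6) p.164 (class form)] -/
theorem condCov_kernel_eq_zero_of_not_mem (Γ : Finset (B1Eq324BenfattoLemma.Site d)) {x y : B1Eq324BenfattoLemma.Site d}
    (h : x ∉ Λ ∨ y ∉ Λ) : condCov K Γ x y = 0 := by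
  rw [condCov]
  rcases h with hx | hy
  · rw [kernel_eq_zero_of_not_mem_left hK hx, zero_sub, neg_eq_zero]
    exact Finset.sum_eq_zero fun c _ => Finset.sum_eq_zero fun c' _ => by
      rw [kernel_eq_zero_of_not_mem_left hK hx, zero_mul, zero_mul]
  · rw [kernel_eq_zero_of_not_mem_right hK x hy, zero_sub, neg_eq_zero]
    exact Finset.sum_eq_zero fun c _ => Finset.sum_eq_zero fun c' _ => by
      rw [kernel_eq_zero_of_not_mem_right hK _ hy, mul_zero]

/-- Off `Λ` the conditional centre of the class kernel vanishes. [cite: BenfattoEtAl1978, Appendix C (C.7) p.164 (class form)] -/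
theorem condMean_kernel_eq_zero_of_not_mem (Γ : Finset (B1Eq324BenfattoLemma.Site d)) (ξ : B1Eq324BenfattoLemma.Site d → ℝ)
    {x : B1Eq324BenfattoLemma.Site d} (hx : x ∉ Λ) : condMean K Γ ξ x = 0 := by
  rw [condMean]
  exact Finset.sum_eq_zero fun c _ => Finset.sum_eq_zero fun c' _ => by
    rw [kernel_eq_zero_of_not_mem_left hK hx, zero_mul, zero_mul]

/-! ## §3  Seat n08-b's class theorems in the `Q₀` currency -/

/-- **«DIRICHLET BOUNDARY CONDITION ON Γ» FOR THE CLASS**: for `Γ ⊆ Λ` and `x, y ∈ Λ ∖ Γ`, the conditional covariance of the class field is the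
inverse of the principal precision block: `condCov K Γ x y = ((A|_{Λ∖Γ})⁻¹)_{xy}` (the block indexed by the complement of `Γ_Λ` in `Λ`;
n08-b's `schur_eq_inv_submatrix_compl` through the bridge). [cite: BenfattoEtAl1978, Appendix C point 2) (C.6)–(C.7) p.164 (class form)] -/
theorem condCov_kernel_eq_inv_submatrix (hA : A.PosDef) {Γ : Finset (B1Eq324BenfattoLemma.Site d)} (hΓ : Γ ⊆ Λ)
    {x y : B1Eq324BenfattoLemma.Site d} (hx : x ∈ Λ) (hxΓ : x ∉ Γ) (hy : y ∈ Λ) (hyΓ : y ∉ Γ) :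
    condCov K Γ x y =
      (A.submatrix (fun j : ↥(Γ.subtype (· ∈ Λ))ᶜ => (j : Λ)) (fun j : ↥(Γ.subtype (· ∈ Λ))ᶜ => (j : Λ)))⁻¹
        ⟨⟨x, hx⟩, mem_compl_subtype hx hxΓ⟩ ⟨⟨y, hy⟩, mem_compl_subtype hy hyΓ⟩ := by
  rw [condCov_kernel_eq_schur hK hΓ hx hy]
  exact schur_eq_inv_submatrix_compl hA (Γ.subtype (· ∈ Λ)) ⟨⟨x, hx⟩, mem_compl_subtype hx hxΓ⟩ ⟨⟨y, hy⟩, mem_compl_subtype hy hyΓ⟩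

/-- **THE DIRICHLET COVARIANCE AS A GRAM MATRIX, in `Q₀` indexing**: for `Γ ⊆ Λ`, the Gram matrix of `condCov K Γ` on `Λ ∖ Γ` IS the inverse
of the precision block `A|_{Λ∖Γ}` (indexed by `↥(Λ ∖ Γ)` itself — no detour through `Γ_Λᶜ`): `covGram (condCov K Γ) (Λ ∖ Γ) = (A|_{Λ∖Γ})⁻¹`.  This is
the form in which a precision-side comparison (seat n08-b's `…ClassDecoupling`) meets the conditioned field's finite-dimensional law.
[cite: BenfattoEtAl1978, Appendix C point 2) (C.6)–(C.7) p.164 (class form)] -/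
theorem covGram_condCov_kernel_eq_inv_submatrix (hA : A.PosDef) {Γ : Finset (B1Eq324BenfattoLemma.Site d)} (hΓ : Γ ⊆ Λ) :
    covGram (condCov K Γ) (Λ \ Γ) =
      (A.submatrix (fun j : ↥(Λ \ Γ) => (⟨j, (Finset.mem_sdiff.mp j.2).1⟩ : Λ))
        (fun j : ↥(Λ \ Γ) => (⟨j, (Finset.mem_sdiff.mp j.2).1⟩ : Λ)))⁻¹ := by
  classical
  let e : ↥(Λ \ Γ) ≃ ↥(Γ.subtype (· ∈ Λ))ᶜ :=
    { toFun := fun j => ⟨⟨j, (Finset.mem_sdiff.mp j.2).1⟩,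
        mem_compl_subtype (Finset.mem_sdiff.mp j.2).1 (Finset.mem_sdiff.mp j.2).2⟩
      invFun := fun k => ⟨((k : Λ) : B1Eq324BenfattoLemma.Site d), Finset.mem_sdiff.mpr ⟨(k : Λ).2,
        fun h => (Finset.mem_compl.mp k.2) (Finset.mem_subtype.mpr h)⟩⟩
      left_inv := fun j => Subtype.ext rfl
      right_inv := fun k => Subtype.ext (Subtype.ext rfl) }
  have hsub : A.submatrix (fun j : ↥(Λ \ Γ) => (⟨j, (Finset.mem_sdiff.mp j.2).1⟩ : Λ))
        (fun j : ↥(Λ \ Γ) => (⟨j, (Finset.mem_sdiff.mp j.2).1⟩ : Λ)) =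
      (A.submatrix (fun j : ↥(Γ.subtype (· ∈ Λ))ᶜ => (j : Λ)) (fun j : ↥(Γ.subtype (· ∈ Λ))ᶜ => (j : Λ))).submatrix e e := by
    ext j j'
    rfl
  rw [hsub, Matrix.inv_submatrix_equiv]
  ext x y
  rw [covGram_apply, Matrix.submatrix_apply,
    condCov_kernel_eq_inv_submatrix hK hA hΓ (Finset.mem_sdiff.mp x.2).1 (Finset.mem_sdiff.mp x.2).2
      (Finset.mem_sdiff.mp y.2).1 (Finset.mem_sdiff.mp y.2).2]
  rfl

omit hK in
/-- The precision block `A|_{Λ∖Γ}` in `Q₀` indexing is positive definite (so is its inverse, the Dirichlet Gram matrix above).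
[cite: BenfattoEtAl1978, Appendix C point 2) (C.6) p.164 (class form)] -/
theorem posDef_submatrix_sdiff (hA : A.PosDef) (Γ : Finset (B1Eq324BenfattoLemma.Site d)) :
    (A.submatrix (fun j : ↥(Λ \ Γ) => (⟨j, (Finset.mem_sdiff.mp j.2).1⟩ : Λ))
        (fun j : ↥(Λ \ Γ) => (⟨j, (Finset.mem_sdiff.mp j.2).1⟩ : Λ))).PosDef :=
  hA.submatrix fun a b hab => Subtype.ext (by simpa using congrArg Subtype.val hab)

section ClassBounds

variable {dist : B1Eq324BenfattoLemma.Site d → B1Eq324BenfattoLemma.Site d → ℝ} {γ J κ : ℝ}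

/-- **(C.6) diagonal, for the class**: for `x ∈ Λ ∖ Γ`, `0 < condCov K Γ x x ≤ 1/γ` (`γ` the ellipticity constant of `A`).
[cite: BenfattoEtAl1978, Appendix C (C.6) p.164 (class form, diagonal)] -/
theorem condCov_kernel_self_pos_le (hAs : ∀ e e', A e e' = A e' e) (hγ0 : 0 < γ)
    (hγ : ∀ v : Λ → ℝ, γ * ∑ e, v e ^ 2 ≤ ∑ e, ∑ e', A e e' * v e * v e') {Γ : Finset (B1Eq324BenfattoLemma.Site d)} (hΓ : Γ ⊆ Λ)
    {x : B1Eq324BenfattoLemma.Site d} (hx : x ∈ Λ) (hxΓ : x ∉ Γ) :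
    0 < condCov K Γ x x ∧ condCov K Γ x x ≤ 1 / γ := by
  rw [condCov_kernel_eq_schur hK hΓ hx hx]
  exact schur_self_pos_le hAs hγ0 hγ (Γ.subtype (· ∈ Λ)) ⟨⟨x, hx⟩, mem_compl_subtype hx hxΓ⟩

/-- **F2 — (C.2) for the class**: `|K(x, y)| ≤ e^{−κ·dist x y}/(γ − J)` for ALL `x, y` (zero off `Λ`), for a uniformly elliptic precision with
Combes–Thomas row defect `J < γ` (n08-b's `abs_inv_apply_le_exp` through the bridge). [cite: BenfattoEtAl1978, Appendix C (C.2) p.164 (class form; route: Combes–Thomas 1973)] -/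
theorem abs_kernel_le_exp (hAs : ∀ e e', A e e' = A e' e)
    (hd0 : ∀ e, dist e e = 0) (hdsymm : ∀ e e', dist e e' = dist e' e) (hdtri : ∀ e e' e'', dist e e'' ≤ dist e e' + dist e' e'')
    (hγ0 : 0 < γ) (hγ : ∀ v : Λ → ℝ, γ * ∑ e, v e ^ 2 ≤ ∑ e, ∑ e', A e e' * v e * v e')
    (hJ : ∀ e : Λ, ∑ e' : Λ, |A e e'| * (Real.cosh (κ * dist e e') - 1) ≤ J) (hκ : 0 ≤ κ) (hm : J < γ)
    (x y : B1Eq324BenfattoLemma.Site d) : |K x y| ≤ Real.exp (-(κ * dist x y)) / (γ - J) := by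
  have hγJ : 0 < γ - J := by linarith
  by_cases hx : x ∈ Λ
  · by_cases hy : y ∈ Λ
    · rw [kernel_apply_of_mem hK hx hy]
      exact abs_inv_apply_le_exp hAs (dist := fun i j : Λ => dist i j) (fun e => hd0 e) (fun e e' => hdsymm e e')
        (fun e e' e'' => hdtri e e' e'') hγ0 hγ hJ hκ hm ⟨x, hx⟩ ⟨y, hy⟩
    · rw [kernel_eq_zero_of_not_mem_right hK x hy, abs_zero]
      exact div_nonneg (Real.exp_pos _).le hγJ.le
  · rw [kernel_eq_zero_of_not_mem_left hK hx, abs_zero]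
    exact div_nonneg (Real.exp_pos _).le hγJ.le

/-- **F4 — (C.6) for the class, UNIFORMLY IN THE CONDITIONING SET**: for every `Γ ⊆ Λ` and ALL `x, y`,
`|condCov K Γ x y| ≤ e^{−κ·dist x y}/(γ − J)` — the conditional covariance decays with the UNCONDITIONED class constants (zero across `Γ` and off `Λ`;
on `Λ ∖ Γ` n08-b's `abs_schur_le_exp` through the bridge). [cite: BenfattoEtAl1978, Appendix C (C.6) p.164 (class form; route: Combes–Thomas 1973)] -/
theorem abs_condCov_kernel_le_exp (hAs : ∀ e e', A e e' = A e' e)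
    (hd0 : ∀ e, dist e e = 0) (hdsymm : ∀ e e', dist e e' = dist e' e) (hdtri : ∀ e e' e'', dist e e'' ≤ dist e e' + dist e' e'')
    (hγ0 : 0 < γ) (hγ : ∀ v : Λ → ℝ, γ * ∑ e, v e ^ 2 ≤ ∑ e, ∑ e', A e e' * v e * v e')
    (hJ : ∀ e : Λ, ∑ e' : Λ, |A e e'| * (Real.cosh (κ * dist e e') - 1) ≤ J) (hκ : 0 ≤ κ) (hm : J < γ)
    {Γ : Finset (B1Eq324BenfattoLemma.Site d)} (hΓ : Γ ⊆ Λ) (x y : B1Eq324BenfattoLemma.Site d) :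
    |condCov K Γ x y| ≤ Real.exp (-(κ * dist x y)) / (γ - J) := by
  have hγJ : 0 < γ - J := by linarith
  have hPD : A.PosDef := posDef_of_coercive hAs hγ0 hγ
  have hdet : IsUnit (covGram K Γ).det := isUnit_det_covGram_kernel hK hPD hΓ
  have hpos : 0 ≤ Real.exp (-(κ * dist x y)) / (γ - J) := div_nonneg (Real.exp_pos _).le hγJ.le
  by_cases hx : x ∈ Λ
  · by_cases hy : y ∈ Λ
    · by_cases hxΓ : x ∈ Γ
      · rw [condCov_of_mem_left Γ hdet hxΓ, abs_zero]
        exact hpos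
      · by_cases hyΓ : y ∈ Γ
        · rw [condCov_of_mem_right (kernel_comm hK hPD) Γ hdet x hyΓ, abs_zero]
          exact hpos
        · rw [condCov_kernel_eq_schur hK hΓ hx hy]
          exact abs_schur_le_exp hAs (dist := fun i j : Λ => dist i j) (fun e => hd0 e) (fun e e' => hdsymm e e')
            (fun e e' e'' => hdtri e e' e'') hγ0 hγ hJ hκ hm (Γ.subtype (· ∈ Λ))
            ⟨⟨x, hx⟩, mem_compl_subtype hx hxΓ⟩ ⟨⟨y, hy⟩, mem_compl_subtype hy hyΓ⟩
    · rw [condCov_kernel_eq_zero_of_not_mem hK Γ (Or.inr hy), abs_zero]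
      exact hpos
  · rw [condCov_kernel_eq_zero_of_not_mem hK Γ (Or.inl hx), abs_zero]
    exact hpos

/-- **F5 — (C.8) for the class**: boundary data `|ξ_c| ≤ t(1 + δ_c)` on `Γ` for a profile `δ ≥ 0` that is 1-Lipschitz for `dist`, growth constants
`Σ_{e′} e^{−κ·dist e e′}(1 + dist e e′) ≤ V`, `Σ_{e′} |A e e′|(1 + dist e e′) ≤ M` ⇒ for every `x ∈ Λ ∖ Γ`,
`|condMean K Γ ξ x| ≤ (VM/(γ − J))·t·(1 + δ_x)` (off `Λ` the centre is `0`, `condMean_kernel_eq_zero_of_not_mem`; n08-b's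
`abs_regression_le_profile` through the bridge) — print's
`|u_Δ| ≤ ((α² + 2d)/α²)² b(1 + d(Δ, I))` for the class. [cite: BenfattoEtAl1978, Appendix C (C.8) p.164 (class form)] -/
theorem abs_condMean_kernel_le_profile (hAs : ∀ e e', A e e' = A e' e)
    (hd0 : ∀ e, dist e e = 0) (hdsymm : ∀ e e', dist e e' = dist e' e) (hdtri : ∀ e e' e'', dist e e'' ≤ dist e e' + dist e' e'')
    (hγ0 : 0 < γ) (hγ : ∀ v : Λ → ℝ, γ * ∑ e, v e ^ 2 ≤ ∑ e, ∑ e', A e e' * v e * v e')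
    (hJ : ∀ e : Λ, ∑ e' : Λ, |A e e'| * (Real.cosh (κ * dist e e') - 1) ≤ J) (hκ : 0 ≤ κ) (hm : J < γ)
    {V M t : ℝ} (hV : ∀ e : Λ, ∑ e' : Λ, Real.exp (-(κ * dist e e')) * (1 + dist e e') ≤ V)
    (hM : ∀ e : Λ, ∑ e' : Λ, |A e e'| * (1 + dist e e') ≤ M) (ht : 0 ≤ t)
    (δ : B1Eq324BenfattoLemma.Site d → ℝ) (hδ0 : ∀ e, 0 ≤ δ e) (hδ : ∀ e e', δ e' ≤ δ e + dist e e')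
    {Γ : Finset (B1Eq324BenfattoLemma.Site d)} (hΓ : Γ ⊆ Λ) (ξ : B1Eq324BenfattoLemma.Site d → ℝ)
    (hξ : ∀ c ∈ Γ, |ξ c| ≤ t * (1 + δ c)) {x : B1Eq324BenfattoLemma.Site d} (hx : x ∈ Λ) (hxΓ : x ∉ Γ) :
    |condMean K Γ ξ x| ≤ V * M / (γ - J) * t * (1 + δ x) := by
  rw [condMean_kernel_eq_regression hK hΓ ξ hx]
  exact abs_regression_le_profile hAs (dist := fun i j : Λ => dist i j) (fun e => hd0 e) (fun e e' => hdsymm e e')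
    (fun e e' e'' => hdtri e e' e'') hγ0 hγ hJ hκ hm hV hM ht (fun j : Λ => δ j) (fun e => hδ0 e) (fun e e' => hδ e e')
    (Γ.subtype (· ∈ Λ)) (fun j : Λ => ξ j) (fun c hc => hξ c (Finset.mem_subtype.mp hc)) ⟨⟨x, hx⟩, mem_compl_subtype hx hxΓ⟩

/-- **F7 — (C.7) for the class, the conditioning correction**: for `x, y ∈ Λ ∖ Γ` (`Γ ⊆ Λ`), with the half-rate growth constants
`Σ_{e′} e^{−(κ/2)·dist e e′} ≤ V₂`, `Σ_{e′} |A e e′|e^{(κ/2)·dist e e′} ≤ M₂` and `D_x ≤ dist x c`, `D_y ≤ dist c y` for all `c ∈ Γ`,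
`|K(x,y) − condCov K Γ x y| ≤ (V₂M₂/(γ − J)²)·e^{−(κ/2)(D_x + D_y)}` (off `Λ` both terms vanish: `kernel_eq_zero_of_not_mem_*`,
`condCov_kernel_eq_zero_of_not_mem`; n08-b's `abs_cov_sub_schur_le_exp` through the bridge). [cite: BenfattoEtAl1978, Appendix C (C.6)–(C.7) p.164 (class form)] -/
theorem abs_kernel_sub_condCov_le_exp (hAs : ∀ e e', A e e' = A e' e)
    (hd0 : ∀ e, dist e e = 0) (hdsymm : ∀ e e', dist e e' = dist e' e) (hdtri : ∀ e e' e'', dist e e'' ≤ dist e e' + dist e' e'')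
    (hγ0 : 0 < γ) (hγ : ∀ v : Λ → ℝ, γ * ∑ e, v e ^ 2 ≤ ∑ e, ∑ e', A e e' * v e * v e')
    (hJ : ∀ e : Λ, ∑ e' : Λ, |A e e'| * (Real.cosh (κ * dist e e') - 1) ≤ J) (hκ : 0 ≤ κ) (hm : J < γ)
    {V₂ M₂ : ℝ} (hV : ∀ e : Λ, ∑ e' : Λ, Real.exp (-(κ / 2 * dist e e')) ≤ V₂)
    (hM : ∀ e : Λ, ∑ e' : Λ, |A e e'| * Real.exp (κ / 2 * dist e e') ≤ M₂)
    {Γ : Finset (B1Eq324BenfattoLemma.Site d)} (hΓ : Γ ⊆ Λ) {x y : B1Eq324BenfattoLemma.Site d} (hx : x ∈ Λ) (hxΓ : x ∉ Γ) (hy : y ∈ Λ) (hyΓ : y ∉ Γ)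
    {Dx Dy : ℝ} (hDx : ∀ c ∈ Γ, Dx ≤ dist x c) (hDy : ∀ c ∈ Γ, Dy ≤ dist c y) :
    |K x y - condCov K Γ x y| ≤ V₂ * M₂ / (γ - J) ^ 2 * Real.exp (-(κ / 2 * (Dx + Dy))) := by
  rw [condCov_kernel_eq_schur hK hΓ hx hy, kernel_apply_of_mem hK hx hy, sub_sub_cancel]
  exact abs_cov_sub_schur_le_exp hAs (dist := fun i j : Λ => dist i j) (fun e => hd0 e) (fun e e' => hdsymm e e')
    (fun e e' e'' => hdtri e e' e'') hγ0 hγ hJ hκ hm hV hM (Γ.subtype (· ∈ Λ))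
    ⟨⟨x, hx⟩, mem_compl_subtype hx hxΓ⟩ ⟨⟨y, hy⟩, mem_compl_subtype hy hyΓ⟩
    (fun c hc => hDx c (Finset.mem_subtype.mp hc)) (fun c hc => hDy c (Finset.mem_subtype.mp hc))

/-! ### v1.1 (F10): absolute row sums, uniformly in the conditioning set -/

/-- **F10 — (C.5) for the class: absolute row sums of the kernel** over any finite set of sites `S`:
`Σ_{y∈S} |K(x,y)| ≤ (Σ_{y∈S} e^{−κ·dist x y})/(γ − J) ≤ V₀/(γ − J)` (sum F2). [cite: BenfattoEtAl1978, Appendix C (C.5) p.164 (class form)] -/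
theorem sum_abs_kernel_le (hAs : ∀ e e', A e e' = A e' e)
    (hd0 : ∀ e, dist e e = 0) (hdsymm : ∀ e e', dist e e' = dist e' e) (hdtri : ∀ e e' e'', dist e e'' ≤ dist e e' + dist e' e'')
    (hγ0 : 0 < γ) (hγ : ∀ v : Λ → ℝ, γ * ∑ e, v e ^ 2 ≤ ∑ e, ∑ e', A e e' * v e * v e')
    (hJ : ∀ e : Λ, ∑ e' : Λ, |A e e'| * (Real.cosh (κ * dist e e') - 1) ≤ J) (hκ : 0 ≤ κ) (hm : J < γ)
    (S : Finset (B1Eq324BenfattoLemma.Site d)) (x : B1Eq324BenfattoLemma.Site d) {V₀ : ℝ} (hV : ∑ y ∈ S, Real.exp (-(κ * dist x y)) ≤ V₀) :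
    ∑ y ∈ S, |K x y| ≤ V₀ / (γ - J) := by
  have hγJ : 0 < γ - J := by linarith
  calc ∑ y ∈ S, |K x y| ≤ ∑ y ∈ S, Real.exp (-(κ * dist x y)) / (γ - J) :=
        Finset.sum_le_sum fun y _ => abs_kernel_le_exp hK hAs hd0 hdsymm hdtri hγ0 hγ hJ hκ hm x y
    _ = (∑ y ∈ S, Real.exp (-(κ * dist x y))) / (γ - J) := by rw [Finset.sum_div]
    _ ≤ V₀ / (γ - J) := div_le_div_of_nonneg_right hV hγJ.le

/-- **F10 — (C.5)/(C.6) for the class: absolute row sums of the CONDITIONAL covariance, UNIFORMLY IN `Γ ⊆ Λ`**, over any finite set of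
sites `S`: `Σ_{y∈S} |condCov K Γ x y| ≤ V₀/(γ − J)` whenever `Σ_{y∈S} e^{−κ·dist x y} ≤ V₀` (sum F4) — the class replacement of the free
field's row sum `Σ_y C(x,y) = 1/(α²β)` used by `…Sect5LegGeometry` / `…Sect5CondToFree` (census §3.3 H6).
[cite: BenfattoEtAl1978, Appendix C (C.5)–(C.6) p.164 (class form)] -/
theorem sum_abs_condCov_kernel_le (hAs : ∀ e e', A e e' = A e' e)
    (hd0 : ∀ e, dist e e = 0) (hdsymm : ∀ e e', dist e e' = dist e' e) (hdtri : ∀ e e' e'', dist e e'' ≤ dist e e' + dist e' e'')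
    (hγ0 : 0 < γ) (hγ : ∀ v : Λ → ℝ, γ * ∑ e, v e ^ 2 ≤ ∑ e, ∑ e', A e e' * v e * v e')
    (hJ : ∀ e : Λ, ∑ e' : Λ, |A e e'| * (Real.cosh (κ * dist e e') - 1) ≤ J) (hκ : 0 ≤ κ) (hm : J < γ)
    {Γ : Finset (B1Eq324BenfattoLemma.Site d)} (hΓ : Γ ⊆ Λ) (S : Finset (B1Eq324BenfattoLemma.Site d)) (x : B1Eq324BenfattoLemma.Site d) {V₀ : ℝ}
    (hV : ∑ y ∈ S, Real.exp (-(κ * dist x y)) ≤ V₀) :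
    ∑ y ∈ S, |condCov K Γ x y| ≤ V₀ / (γ - J) := by
  have hγJ : 0 < γ - J := by linarith
  calc ∑ y ∈ S, |condCov K Γ x y| ≤ ∑ y ∈ S, Real.exp (-(κ * dist x y)) / (γ - J) :=
        Finset.sum_le_sum fun y _ => abs_condCov_kernel_le_exp hK hAs hd0 hdsymm hdtri hγ0 hγ hJ hκ hm hΓ x y
    _ = (∑ y ∈ S, Real.exp (-(κ * dist x y))) / (γ - J) := by rw [Finset.sum_div]
    _ ≤ V₀ / (γ - J) := div_le_div_of_nonneg_right hV hγJ.le

/-- **(C.4) for the class — the one-site variance**: `0 < K(x,x) ≤ 1/γ` on `Λ` (n08-b's `inv_apply_self_pos_le`), `K(x,x) = 0` off `Λ`; in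
particular `K(x,x) ≤ 1/γ` for ALL `x` — the diagonal bound the kernel-generic Appendix A (`…AppendixA` §1 `smallField_real_ge_of_sum_le`) and
Lemma 2 (`…KernelAppendixCLemma2`) consume in place of «E z_Δ² = ½». [cite: BenfattoEtAl1978, Appendix C (C.4) p.164; Appendix A (A.1) p.161 (class form)] -/
theorem kernel_self_le (hAs : ∀ e e', A e e' = A e' e) (hγ0 : 0 < γ)
    (hγ : ∀ v : Λ → ℝ, γ * ∑ e, v e ^ 2 ≤ ∑ e, ∑ e', A e e' * v e * v e') (x : B1Eq324BenfattoLemma.Site d) :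
    0 ≤ K x x ∧ K x x ≤ 1 / γ := by
  by_cases hx : x ∈ Λ
  · rw [kernel_apply_of_mem hK hx hx]
    have h := inv_apply_self_pos_le hAs hγ0 hγ (⟨x, hx⟩ : Λ)
    exact ⟨h.1.le, h.2⟩
  · rw [kernel_eq_zero_of_not_mem_left hK hx]
    exact ⟨le_rfl, by positivity⟩

/-- **(C.4) for the class, strict form on `Λ`**: `0 < K(x,x) ≤ 1/γ` for `x ∈ Λ` (the one-site marginal is a non-degenerate Gaussian).
[cite: BenfattoEtAl1978, Appendix C (C.4) p.164 (class form)] -/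
theorem kernel_self_pos_le (hAs : ∀ e e', A e e' = A e' e) (hγ0 : 0 < γ)
    (hγ : ∀ v : Λ → ℝ, γ * ∑ e, v e ^ 2 ≤ ∑ e, ∑ e', A e e' * v e * v e') {x : B1Eq324BenfattoLemma.Site d} (hx : x ∈ Λ) :
    0 < K x x ∧ K x x ≤ 1 / γ := by
  rw [kernel_apply_of_mem hK hx hx]
  exact inv_apply_self_pos_le hAs hγ0 hγ (⟨x, hx⟩ : Λ)

end ClassBounds

/-! ## §4  The Markov property and the locality of the centre for a separating conditioning set -/

/-- **F8 — THE MARKOV PROPERTY FOR THE CLASS (separating conditioning set)**: if the precision `A` has no entries between the two sides of a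
predicate `p` away from `Γ` (`A z w = 0` for `z, w ∈ Λ ∖ Γ` on different sides), then the conditional covariance of the class kernel VANISHES
across the sides: `condCov K Γ x y = 0` whenever `¬(p x ↔ p y)`, for ALL `x, y` (on `Γ` and off `Λ` it vanishes anyway) — the covariance content
of «factorize over the boxes □» (p.153) / the hypothesis of `…KernelCondField.iIndepFun_condFieldK_of_condCov_eq_zero`; n08-b's
`…ClassMarkov.schur_eq_zero_of_separated` through the bridge. [cite: BenfattoEtAl1978, §5 (5.13) p.155 «the Markov property of P has been used» (class form)] -/
theorem condCov_kernel_eq_zero_of_separated (hA : A.PosDef) {Γ : Finset (B1Eq324BenfattoLemma.Site d)} (hΓ : Γ ⊆ Λ)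
    (p : B1Eq324BenfattoLemma.Site d → Prop) [DecidablePred p]
    (hsep : ∀ z w : Λ, (z : B1Eq324BenfattoLemma.Site d) ∉ Γ → (w : B1Eq324BenfattoLemma.Site d) ∉ Γ → ¬ (p z ↔ p w) → A z w = 0)
    {x y : B1Eq324BenfattoLemma.Site d} (hxy : ¬ (p x ↔ p y)) : condCov K Γ x y = 0 := by
  classical
  have hdet : IsUnit (covGram K Γ).det := isUnit_det_covGram_kernel hK hA hΓ
  by_cases hx : x ∈ Λ
  · by_cases hy : y ∈ Λ
    · by_cases hxΓ : x ∈ Γ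
      · exact condCov_of_mem_left Γ hdet hxΓ y
      · by_cases hyΓ : y ∈ Γ
        · exact condCov_of_mem_right (kernel_comm hK hA) Γ hdet x hyΓ
        · rw [condCov_kernel_eq_schur hK hΓ hx hy]
          exact schur_eq_zero_of_separated hA (Γ.subtype (· ∈ Λ)) (fun j : Λ => p j)
            (fun z w hz hw h => hsep z w (fun hz' => hz (Finset.mem_subtype.mpr hz')) (fun hw' => hw (Finset.mem_subtype.mpr hw')) h)
            ⟨⟨x, hx⟩, mem_compl_subtype hx hxΓ⟩ ⟨⟨y, hy⟩, mem_compl_subtype hy hyΓ⟩ hxy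
    · exact condCov_kernel_eq_zero_of_not_mem hK Γ (Or.inr hy)
  · exact condCov_kernel_eq_zero_of_not_mem hK Γ (Or.inl hx)

/-- **F9 — LOCALITY OF THE CONDITIONAL CENTRE FOR THE CLASS**: under the same separation, for `x ∈ Λ ∖ Γ` on side `p`, the centre
`condMean K Γ ξ x` depends on the boundary datum `ξ` only at the sites of `Γ` coupled by `A` to side `p` (class form of
`…Markov.condMean_freeCov_congr_of_enclosed`; n08-b's `…ClassMarkov.regression_congr_of_separated` through the bridge).
[cite: BenfattoEtAl1978, Appendix C (C.7) p.164; §5 p.156 «(z_Δ)_{Δ⊂Γ} are fixed» (class form)] -/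
theorem condMean_kernel_congr_of_separated (hA : A.PosDef) {Γ : Finset (B1Eq324BenfattoLemma.Site d)} (hΓ : Γ ⊆ Λ)
    (p : B1Eq324BenfattoLemma.Site d → Prop) [DecidablePred p]
    (hsep : ∀ z w : Λ, (z : B1Eq324BenfattoLemma.Site d) ∉ Γ → (w : B1Eq324BenfattoLemma.Site d) ∉ Γ → ¬ (p z ↔ p w) → A z w = 0)
    (ξ ξ' : B1Eq324BenfattoLemma.Site d → ℝ)
    (hξ : ∀ c : Λ, (c : B1Eq324BenfattoLemma.Site d) ∈ Γ → (∃ z : Λ, (z : B1Eq324BenfattoLemma.Site d) ∉ Γ ∧ p z ∧ A z c ≠ 0) → ξ c = ξ' c)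
    {x : B1Eq324BenfattoLemma.Site d} (hx : x ∈ Λ) (hxΓ : x ∉ Γ) (hpx : p x) :
    condMean K Γ ξ x = condMean K Γ ξ' x := by
  classical
  rw [condMean_kernel_eq_regression hK hΓ ξ hx, condMean_kernel_eq_regression hK hΓ ξ' hx]
  exact regression_congr_of_separated hA (Γ.subtype (· ∈ Λ)) (fun j : Λ => p j)
    (fun z w hz hw h => hsep z w (fun hz' => hz (Finset.mem_subtype.mpr hz')) (fun hw' => hw (Finset.mem_subtype.mpr hw')) h)
    (fun j : Λ => ξ j) (fun j : Λ => ξ' j)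
    (fun c hc hex => hξ c (Finset.mem_subtype.mp hc) (hex.imp fun z hz =>
      ⟨fun hz' => hz.1 (Finset.mem_subtype.mpr hz'), hz.2.1, hz.2.2⟩))
    ⟨⟨x, hx⟩, mem_compl_subtype hx hxΓ⟩ hpx


end Kernel

end Literature.MathematicalPhysics.QuantumFieldTheory.Balaban1983to89.B1Eq324BenfattoKernelOfPrecision

end
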